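import Mathlib
import Summits.RiemannHypothesis.RiemannHypothesis.Theorems.DensityLadderSeparatedTowerGaussian
import Summits.RiemannHypothesis.RiemannHypothesis.Theorems.DensityLadderSeparatedTowerOffDiagonal
import HarnessLib

/-!
# `DensityLadder.SeparatedTowerDensityLine` (item stmt-RiemannHypothesis-24918) — the
# Montgomery–Vaughan lower bound for a finite g-separated family (step (h), lower half, of stub S1)

LINE L57 «sieve sight above the density line» (rh-idea-10 g1), crux K1 `SeparatedTowerDensityLine`,
stub S1 of the registered skeleton `Birth.lean` (seat memo `MEANVALUE-SECOND-READ.md` on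
stmt-RiemannHypothesis-24918).  For a finite family of complex rates `ρ_j = β_j + iγ_j` with
pairwise `g`-separated ordinates and Gaussian width `L = 2/g`, the mean square
`Σ_{i,j} b_i conj(b_j) Ĝ_{ij}`, `Ĝ_{ij} = √(2π)L e^{z_{ij}U + z_{ij}²L²/2}`, `z_{ij} = ρ_i + conj ρ_j`
(the value of `∫|Σ b_i e^{ρ_i u}|² G_L(u−U) du`, file `…Gaussian`), has real part at least
`(1/2)√(2π)L Σ_i |b_i|² e^{2β_iU + 2β_i²L²}`: the diagonal dominates because
`|Ĝ_{ij}| ≤ √(Ĝ_{ii}Ĝ_{jj}) e^{−(γ_i−γ_j)²L²/2}` (AM–GM) and `Σ_{j≠i} e^{−2(γ_i−γ_j)²/g²} ≤ 1/3`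
(g-separation, file `…OffDiagonal`).  No Hilbert inequality is used.
Cell rh-split, seat rh-split-prover-l57 g0.  RH-free, ζ-free; FRONTIER bookkeeping; nothing here
bears on the truth of RH.
-/

set_option linter.dupNamespace false

noncomputable section

open Complex Filter Set MeasureTheory Topology
open scoped Real ComplexConjugate

namespace Summit.RiemannHypothesis.RiemannHypothesis.Theorems.DensityLadderSeparatedTowerMVLower

open Summit.RiemannHypothesis.RiemannHypothesis.Theorems.DensityLadderSeparatedTowerGaussian
open Summit.RiemannHypothesis.RiemannHypothesis.Theorems.DensityLadderSeparatedTowerOffDiagonal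

/-- Numerics of the decoherence constant at width `L = 2/g`: `2 Σ_{n≥0} e^{−2(n+1)²} ≤ 1/3`.
[folklore] -/
theorem two_tsum_exp_neg_two_sq_le :
    2 * ∑' n : ℕ, Real.exp (-(2 * ((n : ℝ) + 1) ^ 2)) ≤ 1 / 3 := by
  set r : ℝ := Real.exp (-2) with hr
  have hr0 : 0 ≤ r := (Real.exp_pos _).le
  have hr7 : r ≤ 1 / 7 := by
    rw [hr, Real.exp_neg, inv_eq_one_div, div_le_div_iff₀ (Real.exp_pos 2) (by norm_num), one_mul, one_mul]
    have h := Real.exp_one_gt_d9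
    have : Real.exp 2 = Real.exp 1 * Real.exp 1 := by rw [← Real.exp_add]; norm_num
    nlinarith
  have hr1 : r < 1 := by linarith
  have hgeo : HasSum (fun n : ℕ ↦ r * r ^ n) (r * (1 - r)⁻¹) :=
    (hasSum_geometric_of_lt_one hr0 hr1).mul_left r
  have hle : ∀ n : ℕ, Real.exp (-(2 * ((n : ℝ) + 1) ^ 2)) ≤ r * r ^ n := by
    intro n
    rw [hr, ← Real.exp_nat_mul, ← Real.exp_add, Real.exp_le_exp]
    have hn : (0 : ℝ) ≤ n := Nat.cast_nonneg n
    nlinarith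
  have hsum : Summable fun n : ℕ ↦ Real.exp (-(2 * ((n : ℝ) + 1) ^ 2)) :=
    Summable.of_nonneg_of_le (fun n ↦ (Real.exp_pos _).le) hle hgeo.summable
  have h1 : ∑' n : ℕ, Real.exp (-(2 * ((n : ℝ) + 1) ^ 2)) ≤ r * (1 - r)⁻¹ := by
    rw [← hgeo.tsum_eq]; exact hsum.tsum_le_tsum hle hgeo.summable
  have h2 : r * (1 - r)⁻¹ ≤ 1 / 6 := by
    rw [← div_eq_mul_inv, div_le_div_iff₀ (by linarith) (by norm_num)]; nlinarith
  linarith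

/-- **Montgomery–Vaughan lower bound for a finite g-separated family (Gaussian form, `L = 2/g`).**
For a finite index set `F`, rates `ρ_j = β_j + iγ_j` with `g ≤ |γ_i − γ_j|` for `i ≠ j` in `F`,
coefficients `b_j`, and `U ∈ ℝ`:
`Re Σ_{i,j∈F} b_i conj(b_j) √(2π)L e^{z_{ij}U + z_{ij}²L²/2} ≥ (1/2) √(2π)L Σ_{i∈F} |b_i|² e^{2β_iU + 2β_i²L²}`
where `z_{ij} = (β_i + β_j) + i(γ_i − γ_j)` and `L = 2/g`. [cite: MontgomeryVaughan1974, Thm 1 (smoothed form; here elementary)] -/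
theorem mv_lower_bound {ι : Type} [DecidableEq ι] (F : Finset ι) (β γ : ι → ℝ) (b : ι → ℂ)
    {g : ℝ} (hg : 0 < g) (hsep : ∀ i ∈ F, ∀ j ∈ F, i ≠ j → g ≤ |γ i - γ j|) (U : ℝ) :
    (1 / 2) * (Real.sqrt (2 * π) * (2 / g)) *
        ∑ i ∈ F, ‖b i‖ ^ 2 * Real.exp (2 * β i * U + 2 * β i ^ 2 * (2 / g) ^ 2) ≤
      (∑ i ∈ F, ∑ j ∈ F, b i * conj (b j) * (((Real.sqrt (2 * π) * (2 / g) : ℝ) : ℂ) *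
        cexp ((((β i + β j : ℝ) : ℂ) + (γ i - γ j : ℝ) * I) * U +
          (((β i + β j : ℝ) : ℂ) + (γ i - γ j : ℝ) * I) ^ 2 * (2 / g : ℝ) ^ 2 / 2))).re := by
  set L : ℝ := 2 / g with hL
  have hL0 : 0 < L := by positivity
  set c₀ : ℝ := Real.sqrt (2 * π) * L with hc₀
  have hc₀0 : 0 < c₀ := by positivity
  -- amplitudes `a_i = |b_i| e^{β_i U + β_i² L²}`
  set a : ι → ℝ := fun i ↦ ‖b i‖ * Real.exp (β i * U + β i ^ 2 * L ^ 2) with ha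
  have ha0 : ∀ i, 0 ≤ a i := fun i ↦ by positivity
  have hasq : ∀ i, a i ^ 2 = ‖b i‖ ^ 2 * Real.exp (2 * β i * U + 2 * β i ^ 2 * L ^ 2) := by
    intro i; rw [ha]; simp only
    rw [mul_pow, ← Real.exp_nat_mul]; congr 1; push_cast; ring_nf
  -- the Gaussian decoherence factor
  set e : ι → ι → ℝ := fun i j ↦ Real.exp (-((γ i - γ j) ^ 2 * L ^ 2 / 2)) with he
  -- termwise: real part of the (i,j) term
  set T : ι → ι → ℂ := fun i j ↦ b i * conj (b j) * ((c₀ : ℂ) *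
    cexp ((((β i + β j : ℝ) : ℂ) + (γ i - γ j : ℝ) * I) * U +
      (((β i + β j : ℝ) : ℂ) + (γ i - γ j : ℝ) * I) ^ 2 * L ^ 2 / 2)) with hT
  -- diagonal terms are real `= c₀ a_i²`
  have hdiag : ∀ i, (T i i).re = c₀ * a i ^ 2 := by
    intro i
    rw [hT]; simp only
    have harg : (((β i + β i : ℝ) : ℂ) + ((γ i - γ i : ℝ) : ℂ) * I) * U +
        (((β i + β i : ℝ) : ℂ) + ((γ i - γ i : ℝ) : ℂ) * I) ^ 2 * (L : ℂ) ^ 2 / 2 =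
        ((2 * β i * U + 2 * β i ^ 2 * L ^ 2 : ℝ) : ℂ) := by
      push_cast; ring
    rw [harg, ← Complex.ofReal_exp, ← Complex.ofReal_mul, Complex.mul_conj, Complex.normSq_eq_norm_sq,
      ← Complex.ofReal_mul, Complex.ofReal_re, hasq]
    ring
  -- off-diagonal terms: `Re T_ij ≥ -c₀ a_i a_j e_ij`
  have hoff : ∀ i j, -(c₀ * (a i * a j * e i j)) ≤ (T i j).re := by
    intro i j
    have hn : ‖T i j‖ ≤ c₀ * (a i * a j * e i j) := by
      rw [hT]; simp only
      rw [norm_mul, norm_mul, norm_mul, Complex.norm_real, Real.norm_of_nonneg hc₀0.le,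
        Complex.norm_conj]
      have h := norm_cexp_gaussMV_offDiag_le (β i) (β j) (γ i - γ j) U L
      rw [ha, he]; simp only
      calc ‖b i‖ * ‖b j‖ * (c₀ * ‖cexp ((((β i + β j : ℝ) : ℂ) + ((γ i - γ j : ℝ) : ℂ) * I) * U +
            (((β i + β j : ℝ) : ℂ) + ((γ i - γ j : ℝ) : ℂ) * I) ^ 2 * (L : ℂ) ^ 2 / 2)‖)
          ≤ ‖b i‖ * ‖b j‖ * (c₀ * (Real.exp (β i * U + β i ^ 2 * L ^ 2) *
              Real.exp (β j * U + β j ^ 2 * L ^ 2) * Real.exp (-((γ i - γ j) ^ 2 * L ^ 2 / 2)))) := by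
            gcongr
        _ = c₀ * (‖b i‖ * Real.exp (β i * U + β i ^ 2 * L ^ 2) *
              (‖b j‖ * Real.exp (β j * U + β j ^ 2 * L ^ 2)) *
              Real.exp (-((γ i - γ j) ^ 2 * L ^ 2 / 2))) := by ring
    have := Complex.abs_re_le_norm (T i j)
    have := neg_abs_le (T i j).re
    linarith
  -- AM–GM on the off-diagonal: `a_i a_j ≤ (a_i² + a_j²)/2`
  have hamgm : ∀ i j, a i * a j * e i j ≤ (a i ^ 2 + a j ^ 2) / 2 * e i j := fun i j ↦
    mul_le_mul_of_nonneg_right (by nlinarith [sq_nonneg (a i - a j)]) (Real.exp_pos _).le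
  -- the separated sum: `Σ_{j∈F, j≠i} e_ij ≤ 1/3`
  have hsepsum : ∀ i ∈ F, ∑ j ∈ F, (if j = i then 0 else e i j) ≤ 1 / 3 := by
    intro i hi
    -- restrict to the subtype `↥F`, where `γ` is g-separated everywhere
    have hsepF : ∀ x y : ↥F, x ≠ y → g ≤ |γ x - γ y| := fun x y hxy ↦
      hsep x x.2 y y.2 (fun h ↦ hxy (Subtype.ext h))
    have hc : 0 < L ^ 2 / 2 := by positivity
    obtain ⟨hS, hle⟩ := tsum_gauss_sep_le (J := ↥F) (fun x ↦ γ x) hg hsepF ⟨i, hi⟩ hc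
    have hcg : L ^ 2 / 2 * g ^ 2 = 2 := by rw [hL]; field_simp
    rw [hcg] at hle
    have hfin : ∑ j ∈ F, (if j = i then 0 else e i j) =
        ∑' x : ↥F, (if x = ⟨i, hi⟩ then (0 : ℝ) else Real.exp (-(L ^ 2 / 2 * (γ x - γ (⟨i, hi⟩ : ↥F)) ^ 2))) := by
      rw [tsum_fintype, ← Finset.sum_coe_sort F]
      refine Finset.sum_congr rfl fun x _ ↦ ?_
      have : (x : ι) = i ↔ x = ⟨i, hi⟩ := by
        constructor
        · intro h; exact Subtype.ext h
        · intro h; rw [h]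
      by_cases hx : (x : ι) = i
      · rw [if_pos hx, if_pos (this.1 hx)]
      · rw [if_neg hx, if_neg (fun h ↦ hx (this.2 h)), he]
        simp only
        congr 1; ring
    rw [hfin]
    exact hle.trans two_tsum_exp_neg_two_sq_le
  -- assemble
  have hre_sum : (∑ i ∈ F, ∑ j ∈ F, T i j).re = ∑ i ∈ F, ∑ j ∈ F, (T i j).re := by
    rw [Complex.re_sum]; exact Finset.sum_congr rfl fun i _ ↦ Complex.re_sum _ _
  have hsplit : ∀ i ∈ F, c₀ * a i ^ 2 - c₀ * ∑ j ∈ F, (if j = i then 0 else (a i ^ 2 + a j ^ 2) / 2 * e i j) ≤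
      ∑ j ∈ F, (T i j).re := by
    intro i hi
    have : ∑ j ∈ F, (T i j).re = (T i i).re + ∑ j ∈ F.erase i, (T i j).re := by
      rw [← Finset.add_sum_erase F _ hi]
    rw [this, hdiag i]
    have h2 : ∑ j ∈ F, (if j = i then 0 else (a i ^ 2 + a j ^ 2) / 2 * e i j) =
        ∑ j ∈ F.erase i, (a i ^ 2 + a j ^ 2) / 2 * e i j := by
      rw [← Finset.add_sum_erase F _ hi, if_pos rfl, zero_add]
      exact Finset.sum_congr rfl fun j hj ↦ by rw [if_neg (Finset.ne_of_mem_erase hj)]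
    rw [h2, Finset.mul_sum]
    have h3 : ∀ j ∈ F.erase i, -(c₀ * ((a i ^ 2 + a j ^ 2) / 2 * e i j)) ≤ (T i j).re := fun j _ ↦
      le_trans (by nlinarith [hamgm i j, hc₀0]) (hoff i j)
    have := Finset.sum_le_sum h3
    rw [Finset.sum_neg_distrib] at this
    linarith
  -- symmetrise the AM–GM off-diagonal sum
  have hsymm : ∑ i ∈ F, ∑ j ∈ F, (if j = i then 0 else (a i ^ 2 + a j ^ 2) / 2 * e i j) =
      ∑ i ∈ F, a i ^ 2 * ∑ j ∈ F, (if j = i then 0 else e i j) := by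
    have hesymm : ∀ i j, e i j = e j i := fun i j ↦ by rw [he]; simp only; congr 2; ring
    have h1 : ∑ i ∈ F, ∑ j ∈ F, (if j = i then 0 else (a i ^ 2 + a j ^ 2) / 2 * e i j) =
        ∑ i ∈ F, ∑ j ∈ F, (if j = i then 0 else a i ^ 2 / 2 * e i j) +
        ∑ i ∈ F, ∑ j ∈ F, (if j = i then 0 else a j ^ 2 / 2 * e i j) := by
      rw [← Finset.sum_add_distrib]
      refine Finset.sum_congr rfl fun i _ ↦ ?_
      rw [← Finset.sum_add_distrib]
      refine Finset.sum_congr rfl fun j _ ↦ ?_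
      split_ifs <;> ring
    have h2 : ∑ i ∈ F, ∑ j ∈ F, (if j = i then 0 else a j ^ 2 / 2 * e i j) =
        ∑ i ∈ F, ∑ j ∈ F, (if j = i then 0 else a i ^ 2 / 2 * e i j) := by
      rw [Finset.sum_comm]
      refine Finset.sum_congr rfl fun i _ ↦ Finset.sum_congr rfl fun j _ ↦ ?_
      by_cases h : i = j
      · subst h; simp
      · rw [if_neg h, if_neg (Ne.symm h), hesymm]
    rw [h1, h2, ← two_mul, Finset.mul_sum]
    refine Finset.sum_congr rfl fun i _ ↦ ?_
    rw [Finset.mul_sum, Finset.mul_sum]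
    refine Finset.sum_congr rfl fun j _ ↦ ?_
    split_ifs <;> ring
  -- conclude
  have hmain : c₀ * ∑ i ∈ F, a i ^ 2 - c₀ * ∑ i ∈ F, a i ^ 2 * ∑ j ∈ F, (if j = i then 0 else e i j) ≤
      ∑ i ∈ F, ∑ j ∈ F, (T i j).re := by
    have := Finset.sum_le_sum hsplit
    rw [Finset.sum_sub_distrib, ← Finset.mul_sum, ← Finset.mul_sum, hsymm] at this
    exact this
  have hbd : ∑ i ∈ F, a i ^ 2 * ∑ j ∈ F, (if j = i then 0 else e i j) ≤ ∑ i ∈ F, a i ^ 2 * (1 / 3) :=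
    Finset.sum_le_sum fun i hi ↦ mul_le_mul_of_nonneg_left (hsepsum i hi) (sq_nonneg _)
  rw [← Finset.sum_mul] at hbd
  have hA0 : 0 ≤ ∑ i ∈ F, a i ^ 2 := Finset.sum_nonneg fun i _ ↦ sq_nonneg _
  -- rewrite the goal in terms of `T` and `a`
  have hgoal_lhs : ∑ i ∈ F, ‖b i‖ ^ 2 * Real.exp (2 * β i * U + 2 * β i ^ 2 * (2 / g) ^ 2) =
      ∑ i ∈ F, a i ^ 2 := Finset.sum_congr rfl fun i _ ↦ by rw [hasq]
  rw [hgoal_lhs]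
  have hgoal_rhs : (∑ i ∈ F, ∑ j ∈ F, b i * conj (b j) * (((Real.sqrt (2 * π) * (2 / g) : ℝ) : ℂ) *
        cexp ((((β i + β j : ℝ) : ℂ) + (γ i - γ j : ℝ) * I) * U +
          (((β i + β j : ℝ) : ℂ) + (γ i - γ j : ℝ) * I) ^ 2 * (2 / g : ℝ) ^ 2 / 2))).re =
      ∑ i ∈ F, ∑ j ∈ F, (T i j).re := by
    rw [← hre_sum]
  rw [hgoal_rhs]
  nlinarith [mul_le_mul_of_nonneg_left hbd hc₀0.le]

end Summit.RiemannHypothesis.RiemannHypothesis.Theorems.DensityLadderSeparatedTowerMVLower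

end
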